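import Summits.NavierStokesRegularity.NavierStokesRegularity.Theorems.FilamentSkeletonRssKelvinGateTools
import Literature.Analysis.FluidPDE.CaloricRemainderCalculus

/-!
# Route `FilamentSkeletonRss` · ∀-support item `TransverseReduction1ARmod` (stmt-NavierStokesRegularity-23920) · line `defect_column_gate_1AR_mod`,
# stub S2b-mod `GateAssemblyLocMod`: the PATCHING CALCULUS — Leibniz rule for the linearised profile operator under a scalar cutoff

Helper file (theorems only), `--supports stmt-NavierStokesRegularity-23920 --as helper` (also serves 23611 / 21221's S2-type stubs); LEAD of 23611 / registrar
of 23920, lane ns-filament-21221-p1 g14.  Vocabulary of `…KelvinGateDefs` (`lerayLin`).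

THE IDENTITY (`lerayLin_smul`).  For a scalar cutoff `ψ ∈ C²` and a field `W ∈ C²`,
`𝓛_(α,U⁰)(ψW)(y) = ψ(y)·𝓛_(α,U⁰)W(y) + (Dψ(y)[v(y)] − Δψ(y))·W(y) − 2·DW(y)[∇ψ(y)]`,
`v(y) := U⁰(y) + ½y − α e₃ × y` — the FRAME FIELD of the crux (`DefV`: `v = u(X) + ½y − α e₃ × y`).  So the commutator `[𝓛, ψ]` is a ZEROTH-order multiplication
by the transport-diffusion derivative `v·∇ψ − Δψ` of the cutoff plus the first-order cross term `−2 DW[∇ψ]`; it vanishes identically where `ψ` is locally constant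
(`lerayLin_smul_of_fderiv_eq_zero`), and for a partition `ψ₁ + ψ₂ = 1` the two commutators cancel in the sum (`lerayLin_partition`).  This is the bookkeeping
behind the S2b briefs' warning «the scaling transport ½y·∇ is not small on radial cutoffs»: on an annulus `|y| ≍ ρ` of width `≍ ρ`, `|½y·∇ψ| ≍ 1` regardless of
`ρ`, so a patched gate's defect is Y-small only if the cutoffs are adapted to `v` (or the pieces are bordered accordingly) — the ANALYSIS of S2b-mod, untouched here.
HONEST FRAMING: calculus bookkeeping for a HYPOTHETICAL filament-type rotating-self-similar blow-up route (MODEL rung, negative side, SUPPORT item); nothing here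
bears on Navier–Stokes regularity, which is NOT proved.
-/

set_option linter.dupNamespace false

noncomputable section

namespace Summit.NavierStokesRegularity.NavierStokesRegularity.Theorems.KelvinGate

open Set Function Filter
open Literature.Analysis.FluidPDE
open scoped InnerProductSpace Laplacian ContDiff Topology

/-- `e₃ × (c·w) = c·(e₃ × w)` (bilinearity of the cross product, through `crossCLM`). -/
theorem cross_e3_smul (c : ℝ) (w : EuclideanSpace ℝ (Fin 3)) :
    cross (EuclideanSpace.single 2 1) (c • w) = c • cross (EuclideanSpace.single 2 1) w := by
  rw [← crossCLM_apply, map_smul, crossCLM_apply]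

/-- **Leibniz rule for the linearised profile operator under a scalar cutoff.**  For `ψ ∈ C²(ℝ³; ℝ)` and `W ∈ C²(ℝ³; ℝ³)`, at every `y`:
`𝓛_(α,U⁰)(ψW)(y) = ψ(y)·𝓛_(α,U⁰)W(y) + (Dψ(y)[U⁰(y) + ½y − α e₃×y] − Δψ(y))·W(y) − 2·DW(y)[∇ψ(y)]`. -/
theorem lerayLin_smul (α : ℝ) (U0 W : EuclideanSpace ℝ (Fin 3) → EuclideanSpace ℝ (Fin 3)) (ψ : EuclideanSpace ℝ (Fin 3) → ℝ)
    (hψ : ContDiff ℝ 2 ψ) (hW : ContDiff ℝ 2 W) (y : EuclideanSpace ℝ (Fin 3)) :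
    lerayLin α U0 (fun z => ψ z • W z) y =
      ψ y • lerayLin α U0 W y +
        ((fderiv ℝ ψ y (U0 y + (1/2:ℝ) • y - α • cross (EuclideanSpace.single 2 1) y) - (Δ ψ) y) • W y -
          (2:ℝ) • fderiv ℝ W y (gradient ψ y)) := by
  have hψd : DifferentiableAt ℝ ψ y := hψ.differentiable (by norm_num) y
  have hWd : DifferentiableAt ℝ W y := hW.differentiable (by norm_num) y
  have hD : fderiv ℝ (fun z => ψ z • W z) y = ψ y • fderiv ℝ W y + (fderiv ℝ ψ y).smulRight (W y) := fderiv_smul hψd hWd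
  have hDap : ∀ h, fderiv ℝ (fun z => ψ z • W z) y h = ψ y • fderiv ℝ W y h + fderiv ℝ ψ y h • W y := fun h => by
    rw [hD]; rfl
  have hL : (Δ (fun z => ψ z • W z)) y = ψ y • (Δ W) y + (2 : ℝ) • fderiv ℝ W y (gradient ψ y) + ((Δ ψ) y) • W y :=
    laplacian_smul_field hψ hW y
  unfold lerayLin
  rw [hDap, hDap, hDap, hL, cross_e3_smul, map_smul, map_sub, map_add, map_smul, map_smul]
  module

/-- Where the cutoff is LOCALLY CONSTANT to second order (`Dψ(y) = 0`, `Δψ(y) = 0`) the commutator vanishes: `𝓛(ψW)(y) = ψ(y)·𝓛W(y)`. -/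
theorem lerayLin_smul_of_fderiv_eq_zero (α : ℝ) (U0 W : EuclideanSpace ℝ (Fin 3) → EuclideanSpace ℝ (Fin 3)) (ψ : EuclideanSpace ℝ (Fin 3) → ℝ)
    (hψ : ContDiff ℝ 2 ψ) (hW : ContDiff ℝ 2 W) (y : EuclideanSpace ℝ (Fin 3)) (h1 : fderiv ℝ ψ y = 0) (h2 : (Δ ψ) y = 0) :
    lerayLin α U0 (fun z => ψ z • W z) y = ψ y • lerayLin α U0 W y := by
  have hg : gradient ψ y = 0 := by
    rw [gradient, h1, map_zero]
  rw [lerayLin_smul α U0 W ψ hψ hW y, h1, h2, hg]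
  simp

/-- **Partition of unity: the commutators cancel in the sum.**  If `ψ₁ + ψ₂ = 1` (both `C²`) and `W₁, W₂ ∈ C²`, then at every `y`
`𝓛(ψ₁W₁ + ψ₂W₂) = ψ₁·𝓛W₁ + ψ₂·𝓛W₂ + (Dψ₁[v] − Δψ₁)·(W₁ − W₂) − 2·D(W₁ − W₂)[∇ψ₁]` — the patched field's operator is the patched operators plus a
commutator that only sees the DIFFERENCE of the two local pieces on the transition region. -/
theorem lerayLin_partition (α : ℝ) (U0 W₁ W₂ : EuclideanSpace ℝ (Fin 3) → EuclideanSpace ℝ (Fin 3)) (ψ₁ ψ₂ : EuclideanSpace ℝ (Fin 3) → ℝ)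
    (hψ₁ : ContDiff ℝ 2 ψ₁) (hψ₂ : ContDiff ℝ 2 ψ₂) (hsum : ∀ z, ψ₁ z + ψ₂ z = 1) (hW₁ : ContDiff ℝ 2 W₁) (hW₂ : ContDiff ℝ 2 W₂)
    (y : EuclideanSpace ℝ (Fin 3)) :
    lerayLin α U0 (fun z => ψ₁ z • W₁ z + ψ₂ z • W₂ z) y =
      ψ₁ y • lerayLin α U0 W₁ y + ψ₂ y • lerayLin α U0 W₂ y +
        ((fderiv ℝ ψ₁ y (U0 y + (1/2:ℝ) • y - α • cross (EuclideanSpace.single 2 1) y) - (Δ ψ₁) y) • (W₁ y - W₂ y) -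
          (2:ℝ) • (fderiv ℝ W₁ y - fderiv ℝ W₂ y) (gradient ψ₁ y)) := by
  -- `ψ₂ = 1 − ψ₁`, so `Dψ₂ = −Dψ₁`, `∇ψ₂ = −∇ψ₁`, `Δψ₂ = −Δψ₁`
  have hψ₂e : ψ₂ = fun z => 1 - ψ₁ z := by funext z; linarith [hsum z]
  have hψ₁d : DifferentiableAt ℝ ψ₁ y := hψ₁.differentiable (by norm_num) y
  have hD2 : fderiv ℝ ψ₂ y = -fderiv ℝ ψ₁ y := by
    rw [hψ₂e, fderiv_const_sub]
  have hg2 : gradient ψ₂ y = -gradient ψ₁ y := by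
    rw [gradient, gradient, hD2, map_neg]
  have hL2 : (Δ ψ₂) y = -(Δ ψ₁) y := by
    have e1 : ψ₂ = (fun _ : EuclideanSpace ℝ (Fin 3) => (1:ℝ)) - ψ₁ := by
      rw [hψ₂e]; funext z; simp
    rw [e1, ContDiffAt.laplacian_sub (contDiff_const.contDiffAt) (hψ₁.contDiffAt), InnerProductSpace.laplacian_const]
    simp
  -- split by linearity and apply the Leibniz rule to each piece
  have hc₁ : ContDiff ℝ 2 (fun z => ψ₁ z • W₁ z) := hψ₁.smul hW₁
  have hc₂ : ContDiff ℝ 2 (fun z => ψ₂ z • W₂ z) := hψ₂.smul hW₂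
  have hlin := lerayLin_add_smul α 1 U0 (fun z => ψ₁ z • W₁ z) (fun z => ψ₂ z • W₂ z) y hc₁.contDiffAt hc₂.contDiffAt
  simp only [one_smul] at hlin
  rw [hlin, lerayLin_smul α U0 W₁ ψ₁ hψ₁ hW₁ y, lerayLin_smul α U0 W₂ ψ₂ hψ₂ hW₂ y, hD2, hg2, hL2]
  simp only [FunLike.coe_neg, Pi.neg_apply, map_neg, map_sub, FunLike.coe_sub, Pi.sub_apply]
  module

/-! ## Sizes of cut-off fields in the two scales (appended by LEAD g14: partition bookkeeping for data-side and output-side patching) -/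

/-- **Y-scale under a `C¹` cutoff.**  If `|χ| ≤ M` and `‖Dχ‖ ≤ M` pointwise and `F` is Y-bounded by `R`, then `χ·F` is Y-bounded by `2MR`
(`⟨y⟩²|χF| ≤ MR`, `⟨y⟩²|D(χF)| ≤ ⟨y⟩²(|χ||DF| + |Dχ||F|) ≤ 2MR`). -/
theorem YBound.cutoff {χ : EuclideanSpace ℝ (Fin 3) → ℝ} {F : EuclideanSpace ℝ (Fin 3) → EuclideanSpace ℝ (Fin 3)} {M R : ℝ}
    (hχ : ContDiff ℝ 1 χ) (hM : ∀ y, |χ y| ≤ M ∧ ‖fderiv ℝ χ y‖ ≤ M) (hF : YBound F R) :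
    YBound (fun y => χ y • F y) (2 * M * R) := by
  have hR : 0 ≤ R := hF.nonneg
  have hM0 : 0 ≤ M := (abs_nonneg _).trans (hM 0).1
  refine ⟨hχ.smul hF.1, fun y => ⟨?_, ?_⟩⟩
  · obtain ⟨h0, -⟩ := hM y
    calc (1 + ‖y‖) ^ 2 * ‖χ y • F y‖ = |χ y| * ((1 + ‖y‖) ^ 2 * ‖F y‖) := by rw [norm_smul, Real.norm_eq_abs]; ring
      _ ≤ M * R := mul_le_mul h0 (hF.2 y).1 (by positivity) hM0
      _ ≤ 2 * M * R := by nlinarith [mul_nonneg hM0 hR]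
  · obtain ⟨h0, h1⟩ := hM y
    have hχd : DifferentiableAt ℝ χ y := hχ.differentiable (by norm_num) y
    have hFd : DifferentiableAt ℝ F y := hF.1.differentiable (by norm_num) y
    rw [fderiv_fun_smul hχd hFd]
    calc (1 + ‖y‖) ^ 2 * ‖χ y • fderiv ℝ F y + (fderiv ℝ χ y).smulRight (F y)‖
        ≤ (1 + ‖y‖) ^ 2 * (|χ y| * ‖fderiv ℝ F y‖ + ‖fderiv ℝ χ y‖ * ‖F y‖) := by
          refine mul_le_mul_of_nonneg_left ((norm_add_le _ _).trans (add_le_add ?_ ?_)) (by positivity)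
          · rw [norm_smul, Real.norm_eq_abs]
          · rw [ContinuousLinearMap.norm_smulRight_apply]
      _ = |χ y| * ((1 + ‖y‖) ^ 2 * ‖fderiv ℝ F y‖) + ‖fderiv ℝ χ y‖ * ((1 + ‖y‖) ^ 2 * ‖F y‖) := by ring
      _ ≤ M * R + M * R := add_le_add (mul_le_mul h0 (hF.2 y).2 (by positivity) hM0) (mul_le_mul h1 (hF.2 y).1 (by positivity) hM0)
      _ = 2 * M * R := by ring

/-- **X-scale under a `C²` cutoff.**  If `|ψ|, ‖Dψ‖, ‖D²ψ‖ ≤ M` pointwise and `W` is X-bounded by `R`, then `ψ·W` is X-bounded by `4MR`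
(Leibniz: `⟨y⟩|D²(ψW)| ≤ ⟨y⟩(|ψ||D²W| + 2|Dψ||DW| + |D²ψ||W|) ≤ 4MR`).  Note `div(ψW) = ∇ψ·W` — a cut-off solenoidal field is NOT solenoidal. -/
theorem XBound.cutoff {ψ : EuclideanSpace ℝ (Fin 3) → ℝ} {W : EuclideanSpace ℝ (Fin 3) → EuclideanSpace ℝ (Fin 3)} {M R : ℝ}
    (hψ : ContDiff ℝ 2 ψ) (hM : ∀ y, |ψ y| ≤ M ∧ ‖fderiv ℝ ψ y‖ ≤ M ∧ ‖iteratedFDeriv ℝ 2 ψ y‖ ≤ M) (hW : XBound W R) :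
    XBound (fun y => ψ y • W y) (4 * M * R) := by
  have hR : 0 ≤ R := hW.nonneg
  have hM0 : 0 ≤ M := (abs_nonneg _).trans (hM 0).1
  have hMR : 0 ≤ M * R := mul_nonneg hM0 hR
  refine ⟨hψ.smul hW.1, fun y => ⟨?_, ?_, ?_⟩⟩
  · obtain ⟨h0, -, -⟩ := hM y
    calc (1 + ‖y‖) * ‖ψ y • W y‖ = |ψ y| * ((1 + ‖y‖) * ‖W y‖) := by rw [norm_smul, Real.norm_eq_abs]; ring
      _ ≤ M * R := mul_le_mul h0 (hW.2 y).1 (by positivity) hM0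
      _ ≤ 4 * M * R := by nlinarith
  · obtain ⟨h0, h1, -⟩ := hM y
    have hψd : DifferentiableAt ℝ ψ y := hψ.differentiable (by norm_num) y
    have hWd : DifferentiableAt ℝ W y := hW.1.differentiable (by norm_num) y
    rw [fderiv_fun_smul hψd hWd]
    calc (1 + ‖y‖) * ‖ψ y • fderiv ℝ W y + (fderiv ℝ ψ y).smulRight (W y)‖
        ≤ (1 + ‖y‖) * (|ψ y| * ‖fderiv ℝ W y‖ + ‖fderiv ℝ ψ y‖ * ‖W y‖) := by
          refine mul_le_mul_of_nonneg_left ((norm_add_le _ _).trans (add_le_add ?_ ?_)) (by positivity)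
          · rw [norm_smul, Real.norm_eq_abs]
          · rw [ContinuousLinearMap.norm_smulRight_apply]
      _ = |ψ y| * ((1 + ‖y‖) * ‖fderiv ℝ W y‖) + ‖fderiv ℝ ψ y‖ * ((1 + ‖y‖) * ‖W y‖) := by ring
      _ ≤ M * R + M * R := add_le_add (mul_le_mul h0 (hW.2 y).2.1 (by positivity) hM0) (mul_le_mul h1 (hW.2 y).1 (by positivity) hM0)
      _ ≤ 4 * M * R := by nlinarith
  · obtain ⟨h0, h1, h2⟩ := hM y
    have hL := norm_iteratedFDeriv_smul_le hψ hW.1 y (n := 2) (by norm_cast)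
    have e0ψ : ‖iteratedFDeriv ℝ 0 ψ y‖ = |ψ y| := by rw [norm_iteratedFDeriv_zero, Real.norm_eq_abs]
    have e0W : ‖iteratedFDeriv ℝ 0 W y‖ = ‖W y‖ := norm_iteratedFDeriv_zero
    have e1ψ : ‖iteratedFDeriv ℝ 1 ψ y‖ = ‖fderiv ℝ ψ y‖ := by
      rw [← norm_iteratedFDeriv_fderiv, norm_iteratedFDeriv_zero]
    have e1W : ‖iteratedFDeriv ℝ 1 W y‖ = ‖fderiv ℝ W y‖ := by
      rw [← norm_iteratedFDeriv_fderiv, norm_iteratedFDeriv_zero]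
    have hsum : ∑ i ∈ Finset.range (2 + 1), ((2 : ℕ).choose i : ℝ) * ‖iteratedFDeriv ℝ i ψ y‖ * ‖iteratedFDeriv ℝ (2 - i) W y‖ =
        |ψ y| * ‖iteratedFDeriv ℝ 2 W y‖ + 2 * (‖fderiv ℝ ψ y‖ * ‖fderiv ℝ W y‖) + ‖iteratedFDeriv ℝ 2 ψ y‖ * ‖W y‖ := by
      simp only [Finset.sum_range_succ, Finset.sum_range_zero, Nat.choose_zero_right, Nat.choose_self, Nat.cast_one, one_mul, zero_add,
        show (2 : ℕ).choose 1 = 2 by rfl, Nat.cast_ofNat, e0ψ, e0W, e1ψ, e1W]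
      ring
    rw [hsum] at hL
    calc (1 + ‖y‖) * ‖iteratedFDeriv ℝ 2 (fun y => ψ y • W y) y‖
        ≤ (1 + ‖y‖) * (|ψ y| * ‖iteratedFDeriv ℝ 2 W y‖ + 2 * (‖fderiv ℝ ψ y‖ * ‖fderiv ℝ W y‖) + ‖iteratedFDeriv ℝ 2 ψ y‖ * ‖W y‖) :=
          mul_le_mul_of_nonneg_left hL (by positivity)
      _ = |ψ y| * ((1 + ‖y‖) * ‖iteratedFDeriv ℝ 2 W y‖) + 2 * (‖fderiv ℝ ψ y‖ * ((1 + ‖y‖) * ‖fderiv ℝ W y‖)) +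
            ‖iteratedFDeriv ℝ 2 ψ y‖ * ((1 + ‖y‖) * ‖W y‖) := by ring
      _ ≤ M * R + 2 * (M * R) + M * R := by
          refine add_le_add (add_le_add ?_ ?_) ?_
          · exact mul_le_mul h0 (hW.2 y).2.2 (by positivity) hM0
          · exact mul_le_mul_of_nonneg_left (mul_le_mul h1 (hW.2 y).2.1 (by positivity) hM0) (by norm_num)
          · exact mul_le_mul h2 (hW.2 y).1 (by positivity) hM0
      _ = 4 * M * R := by ring

end Summit.NavierStokesRegularity.NavierStokesRegularity.Theorems.KelvinGate

end
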